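import Summits.CriticalPhenomena.PercolationContinuityZ3.Theorems.PercNearOneGluingNoHeavyLowerTailSahiExchangeableLC
import Summits.CriticalPhenomena.PercolationContinuityZ3.Theorems.PercNearOneGluingNoHeavyLowerTailSahiPivotFamilyRefutation
import Mathlib
import HarnessLib
import HarnessLib.Audit.Tags

/-!
# `NoHeavyLowerTail` (crux stmt-CriticalPhenomena-4575), master-family line P1 (gen 18):
# REFUTATION of LC-EXMAX (`LCExmaxNIZ 3`, `LCExmax 3`) — one payer does NOT always suffice at log-concave exchangeable weights

Support file (seat `prim-masterthm-p1`, gen 18; `--supports stmt-CriticalPhenomena-4575`), on top of the tree's `…SahiExchangeableLC`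
(gen 17: `tripleWeight`, `wSideSum` = `Φ_A`/`Φ_B`, `wRainbowSum` = `T`, `LogConcaveWtNIZ`, typed `LCExmax`, `LCExmaxNIZ`) and
`…SahiPivotFamilyRefutation` (gen 15: `lab3`, `lab3_mono`).  Memo `run/shared/lean/prim/prim-masterthm/FROM-prim-masterthm-p1-g18-UNION-CONDITIONED.md` §3b.

THE WITNESS (five coordinates; found by the exhaustive 2⁵ census kit j201882 = all 21 121 450 three-petal sunflower labelings × 40 weight
5-tuples, 70 violations, all of the shape "one steep i.i.d. coordinate + pure δ₁ coordinates + twisted δ₂ coordinates"; re-verified by an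
independent exact script and here by the kernel).  Weights: coordinate `0` i.i.d. with `p = 1/10`, i.e. `(q³,q²p,qp²,p³) ∝ (729,81,9,1)`;
coordinates `1,2` pure `δ₁ = (0,1,0,0)`; coordinates `3,4` twisted `δ₂ = (0,0,1,0)` — all log-concave without internal zeros.  Labeling
`F5 = lab3 (g_X, g_Y, g_Z)` with `A ∪ C_X = ↑1 ∪ ↑04 ∪ ↑234`, `A ∪ C_Y = ↑2 ∪ ↑03 ∪ ↑134`, `A ∪ C_Z = ↑12 ∪ ↑013 ∪ ↑024 ∪ ↑34`
(pairwise intersections all equal to `A = ↑12 ∪ ↑013 ∪ ↑024 ∪ ↑034 ∪ ↑134 ∪ ↑234`; symmetric under `1↔2, 3↔4`).  Then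
`Φ_A = 2322`, `Φ_B = 9720`, `T = 9774 > max(Φ_A, Φ_B)` (`sideA_val`, `sideB_val`, `rainbow_val`, `decide +kernel` on the `ℤ`-valued
copies of the sums; `not_lcExmaxNIZ_three`, `not_lcExmax_three`).  As a function of the i.i.d. bias the same labeling/pattern violates for
every `p ≤ 1/4` (`p = 1/4`: `Φ_A = 5.34, Φ_B = 6.75, T = 7.03`, normalised) and not at `p = 1/3, 1/2`; with a vertex weight or i.i.d.(½) at
coordinate `0` there is no violation — the mechanism is the one that kills LC-gen (`…SahiExchangeableLCRefutation`, gen 18): a free "hub"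
coordinate next to coordinates dealt to fixed numbers of cells.
WHAT SURVIVES.  `PivotDichotomy 3` (all coordinates `δ₁`; exhaustive on 2⁵, 1.6·10⁹ fibres) and S₃^max (all coordinates i.i.d.) are special
weight configurations NOT touched by this witness; the census of gen 16/17 (vertex / i.i.d. / mild log-concave grids on 2⁴) stands.  What dies is
the COMMON PARENT: "for every sunflower labeling and all coordinatewise log-concave exchangeable weights one payer suffices".
HONEST FRAMING: a kernel refutation of two typed conjectures of this line; `PivotDichotomy`, S₃^max, CP3⁺, S₃, the class law remain OPEN. [this work]
-/

namespace Summit.CriticalPhenomena.PercolationContinuityZ3.Theorems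

namespace SahiPivotFamily

open Finset AntipodalStrongHarris AntipodalStrongHarris.Lab

/-! ### 1. Integer-valued weighted sums and their casts -/

/-- The triple weight computed in `ℤ` for `ℤ`-valued coordinate weights (same product as `tripleWeight`). [this work] -/
def tripleWeightInt (S : Finset ℕ) (wz : ℕ → ℕ → ℤ) (x y z : Finset ℕ) : ℤ :=
  ∏ j ∈ S, wz j ((if j ∈ x then 1 else 0) + (if j ∈ y then 1 else 0) + (if j ∈ z then 1 else 0))

/-- The side sum `Φ_a` computed in `ℤ` (same triple sum as `wSideSum`). [this work] -/
def wSideSumInt {k : ℕ} (S : Finset ℕ) (wz : ℕ → ℕ → ℤ) (f : Finset ℕ → Lab k) (a : Lab k) : ℤ :=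
  ∑ x ∈ S.powerset, ∑ y ∈ S.powerset, ∑ z ∈ S.powerset,
    if f x = a then tripleWeightInt S wz x y z * (3 * kappa (f y) (f z)) else 0

/-- The rainbow sum `T` computed in `ℤ` (same triple sum as `wRainbowSum`). [this work] -/
def wRainbowSumInt {k : ℕ} (S : Finset ℕ) (wz : ℕ → ℕ → ℤ) (f : Finset ℕ → Lab k) : ℤ :=
  ∑ x ∈ S.powerset, ∑ y ∈ S.powerset, ∑ z ∈ S.powerset, tripleWeightInt S wz x y z * rainbow (f x) (f y) (f z)

/-- `tripleWeight` at the real cast of `ℤ`-valued weights is the cast of `tripleWeightInt`. [this work] -/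
theorem tripleWeight_intCast (S : Finset ℕ) (wz : ℕ → ℕ → ℤ) (x y z : Finset ℕ) :
    tripleWeight S (fun j c => (wz j c : ℝ)) x y z = (tripleWeightInt S wz x y z : ℝ) := by
  unfold tripleWeight tripleWeightInt; push_cast; rfl

/-- `wSideSum` at the real cast of `ℤ`-valued weights is the cast of `wSideSumInt`. [this work] -/
theorem wSideSum_intCast {k : ℕ} (S : Finset ℕ) (wz : ℕ → ℕ → ℤ) (f : Finset ℕ → Lab k) (a : Lab k) :
    wSideSum S (fun j c => (wz j c : ℝ)) f a = (wSideSumInt S wz f a : ℝ) := by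
  unfold wSideSum wSideSumInt
  rw [Int.cast_sum]; refine sum_congr rfl fun x _ => ?_
  rw [Int.cast_sum]; refine sum_congr rfl fun y _ => ?_
  rw [Int.cast_sum]; refine sum_congr rfl fun z _ => ?_
  rw [tripleWeight_intCast]
  split_ifs <;> push_cast <;> ring

/-- `wRainbowSum` at the real cast of `ℤ`-valued weights is the cast of `wRainbowSumInt`. [this work] -/
theorem wRainbowSum_intCast {k : ℕ} (S : Finset ℕ) (wz : ℕ → ℕ → ℤ) (f : Finset ℕ → Lab k) :
    wRainbowSum S (fun j c => (wz j c : ℝ)) f = (wRainbowSumInt S wz f : ℝ) := by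
  unfold wRainbowSum wRainbowSumInt
  rw [Int.cast_sum]; refine sum_congr rfl fun x _ => ?_
  rw [Int.cast_sum]; refine sum_congr rfl fun y _ => ?_
  rw [Int.cast_sum]; refine sum_congr rfl fun z _ => ?_
  rw [tripleWeight_intCast]; push_cast; ring

/-! ### 2. The witness -/

/-- The weights of the witness in `ℤ`: coordinate `0` carries the i.i.d. weight `(729, 81, 9, 1)` (`p = 1/10`, scaled by `10³`), coordinates
`1, 2` the pure weight `δ₁ = (0,1,0,0)`, every other coordinate (in particular `3, 4`) the twisted vertex weight `δ₂ = (0,0,1,0)`. [this work] -/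
def cex2WtInt : ℕ → ℕ → ℤ := fun j c =>
  if j = 0 then (if c = 0 then 729 else if c = 1 then 81 else if c = 2 then 9 else if c = 3 then 1 else 0)
  else if j = 1 ∨ j = 2 then (if c = 1 then 1 else 0)
  else (if c = 2 then 1 else 0)

/-- The weights of the witness as real numbers. [this work] -/
def cex2Wt : ℕ → ℕ → ℝ := fun j c => (cex2WtInt j c : ℝ)

/-- Every coordinate weight of the witness is log-concave without internal zeros (`δ₁`, `δ₂` trivially; the i.i.d. weight with equality
in all three conditions). [this work] -/
theorem logConcaveWtNIZ_cex2Wt (j : ℕ) : LogConcaveWtNIZ (cex2Wt j) := by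
  unfold LogConcaveWtNIZ LogConcaveWt cex2Wt cex2WtInt
  by_cases h0 : j = 0
  · subst h0
    refine ⟨⟨fun c => ?_, ?_, ?_⟩, ?_⟩ <;> norm_num
    split_ifs <;> norm_num
  · by_cases h12 : j = 1 ∨ j = 2
    · simp only [h0, h12, if_false, if_true]
      refine ⟨⟨fun c => ?_, ?_, ?_⟩, ?_⟩ <;> norm_num
      split_ifs <;> norm_num
    · simp only [h0, h12, if_false]
      refine ⟨⟨fun c => ?_, ?_, ?_⟩, ?_⟩ <;> norm_num
      split_ifs <;> norm_num

/-- Generator `g_X = [1] ∨ [0∧4] ∨ [2∧3∧4]` of the witness labeling (`A ∪ C_X = ↑1 ∪ ↑04 ∪ ↑234`). [this work] -/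
def gX (X : Finset ℕ) : Bool :=
  decide (1 ∈ X) || (decide (0 ∈ X) && decide (4 ∈ X)) || (decide (2 ∈ X) && decide (3 ∈ X) && decide (4 ∈ X))
/-- Generator `g_Y = [2] ∨ [0∧3] ∨ [1∧3∧4]` (`A ∪ C_Y = ↑2 ∪ ↑03 ∪ ↑134`; the image of `g_X` under `1↔2, 3↔4`). [this work] -/
def gY (X : Finset ℕ) : Bool :=
  decide (2 ∈ X) || (decide (0 ∈ X) && decide (3 ∈ X)) || (decide (1 ∈ X) && decide (3 ∈ X) && decide (4 ∈ X))
/-- Generator `g_Z = [1∧2] ∨ [0∧1∧3] ∨ [0∧2∧4] ∨ [3∧4]` (`A ∪ C_Z`). [this work] -/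
def gZ (X : Finset ℕ) : Bool :=
  (decide (1 ∈ X) && decide (2 ∈ X)) || (decide (0 ∈ X) && decide (1 ∈ X) && decide (3 ∈ X)) ||
    (decide (0 ∈ X) && decide (2 ∈ X) && decide (4 ∈ X)) || (decide (3 ∈ X) && decide (4 ∈ X))

/-- The witness labeling on the subsets of `{0,…,4}`: `A` iff at least two generators hold (then all three do: the pairwise intersections of the
`A ∪ C_i` coincide), `C_i` iff exactly `g_i`, `B` iff none (the tree's `lab3`). [this work] -/
def F5 (X : Finset ℕ) : Lab 3 := lab3 (gX X) (gY X) (gZ X)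

/-- `F5` is a sunflower labeling (monotone), by `lab3_mono`. [this work] -/
theorem F5_mono : ∀ ⦃X Y : Finset ℕ⦄, X ⊆ Y → F5 X ≤ F5 Y := by
  intro X Y hXY
  unfold F5
  have h : ∀ n : ℕ, decide (n ∈ X) = true → decide (n ∈ Y) = true := fun n hn => by
    simp only [decide_eq_true_eq] at hn ⊢; exact hXY hn
  apply lab3_mono <;> simp only [gX, gY, gZ, Bool.and_eq_true, Bool.or_eq_true] <;> aesop

/-! ### 3. Kernel evaluation of the three sums (32 768 triples each; `decide +kernel`, deep recursion) -/

set_option maxRecDepth 1000000 in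
set_option maxHeartbeats 2000000 in -- kernel evaluation of a 32 768-term sum (one-off certificate check)
/-- `Φ_A = 2322` (kernel evaluation; the deep recursion needs `maxRecDepth`). [this work] -/
theorem sideA_val : wSideSumInt {0, 1, 2, 3, 4} cex2WtInt F5 top = 2322 := by decide +kernel
set_option maxRecDepth 1000000 in
set_option maxHeartbeats 2000000 in -- kernel evaluation of a 32 768-term sum (one-off certificate check)
/-- `Φ_B = 9720` (kernel evaluation; the deep recursion needs `maxRecDepth`). [this work] -/
theorem sideB_val : wSideSumInt {0, 1, 2, 3, 4} cex2WtInt F5 bot = 9720 := by decide +kernel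
set_option maxRecDepth 1000000 in
set_option maxHeartbeats 2000000 in -- kernel evaluation of a 32 768-term sum (one-off certificate check)
/-- `T = 9774` (kernel evaluation; the deep recursion needs `maxRecDepth`). [this work] -/
theorem rainbow_val : wRainbowSumInt {0, 1, 2, 3, 4} cex2WtInt F5 = 9774 := by decide +kernel

/-! ### 4. The refutations -/

/-- **REFUTATION: `LCExmaxNIZ 3` is false** — at the witness `T = 9774` exceeds both `Φ_A = 2322` and `Φ_B = 9720` although every coordinate
weight is log-concave without internal zeros and the labeling is a sunflower labeling. [this work] -/
theorem not_lcExmaxNIZ_three : ¬ LCExmaxNIZ 3 := by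
  intro h
  have := h {0, 1, 2, 3, 4} F5 cex2Wt F5_mono (fun j _ => logConcaveWtNIZ_cex2Wt j)
  have eA : wSideSum {0, 1, 2, 3, 4} cex2Wt F5 top = 2322 := by
    have := wSideSum_intCast {0, 1, 2, 3, 4} cex2WtInt F5 top; rw [sideA_val] at this; exact_mod_cast this
  have eB : wSideSum {0, 1, 2, 3, 4} cex2Wt F5 bot = 9720 := by
    have := wSideSum_intCast {0, 1, 2, 3, 4} cex2WtInt F5 bot; rw [sideB_val] at this; exact_mod_cast this
  have eT : wRainbowSum {0, 1, 2, 3, 4} cex2Wt F5 = 9774 := by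
    have := wRainbowSum_intCast {0, 1, 2, 3, 4} cex2WtInt F5; rw [rainbow_val] at this; exact_mod_cast this
  rw [eA, eB, eT] at this
  norm_num at this

/-- **REFUTATION: `LCExmax 3` (the larger weight class) is false a fortiori.** [this work] -/
theorem not_lcExmax_three : ¬ LCExmax 3 := fun h => not_lcExmaxNIZ_three (lcExmaxNIZ_of_lcExmax h)

end SahiPivotFamily

end Summit.CriticalPhenomena.PercolationContinuityZ3.Theorems
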